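import Mathlib
import HarnessLib
import Summits.HubbardSuperconductivity.HubbardSuperconductivity.Theses.WeakCouplingBCS
import Summits.HubbardSuperconductivity.HubbardSuperconductivity.Theses.KLProgramme
import Summits.HubbardSuperconductivity.HubbardSuperconductivity.Theorems.WeakCouplingBCSH1TwoPointLimitKLScaleDTypedCrux

/-!
# Route `WeakCouplingBCS` (ladder H3) — the door from the KOHN–LUTTINGER REGIME alone: crux K3 `KLRegimeTwoPointLimit` of route
# `KLProgramme` (control for `e^{a/U} ≤ β ≤ e^{c/U²}`) feeds the H3 door WITHOUT crux K1 `H10TwoPointLimit`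

Cell `gate-hubbard-kl`, seat `hubbard-kl-h1-p1` gen 2 (row «R2dH1 leaf → WeakCouplingBCS/H3 consumers»; LADDER-Hubbard WORDING OF
RECORD (ii)).  Support file for crux 4 `WcbcsBcsConstruction` (stmt-HubbardSuperconductivity-2010); companion of gen 0's
`…Theorems.WeakCouplingBCSH1TwoPointLimitKLScaleDDoor` / `…TypedCrux` and of `…WindowedDoor`.

THE POINT.  The theorem half of rung R2d, the leaf `H1TwoPointLimitKLScaleD` (control for ALL `0 < β ≤ e^{c/U²}`), is decided by route
`KLProgramme` as `closes : H10TwoPointLimit → KLRegimeTwoPointLimit → leaf` — K1 (`H10TwoPointLimit`, stmt-19938: the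
Benfatto–Giuliani–Mastropietro regime `0 < β ≤ e^{a/U}` at intermediate filling, sign-blind; DECOMP C5a, difficulty L, OPEN) glued to
K3 (`KLRegimeTwoPointLimit`, stmt-19937: the Kohn–Luttinger regime `e^{a/U} ≤ β ≤ e^{c/U²}` for every `a > 0`, sign-resolved;
difficulty XL, split into the five `…V7` children).  Gen 0's door relativised crux 4's research stub (M_loc) to normal-phase control
for ALL `β ≤ e^{c/U²}` (hypothesis `hBr`), and so consumed the leaf, i.e. K1 AND K3.  But stage 2 of the weak-coupling BCS programme
— the `h`-seeded symmetry-broken expansion BELOW the Kohn–Luttinger scale — takes its input from stage 1 AT that scale: what it is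
«given» is control in the KL regime, not at high temperature.  Relativising (M_loc) to KL-REGIME control instead (hypothesis `hBrKL`
below: (M_loc)'s signature with ONE antecedent, the body of `KLRegimeTwoPointLimit` transported to the level window) gives a door that
consumes K3 ALONE:

  {K3 `KLRegimeTwoPointLimit` BY NAME, window records A·B·C (cert form (A)), `hBrKL`, crux 2 `WcbcsSsbToTorusLRO` BY NAME} ⇒ `HubbardSuperconductivity`

(`hubbardSuperconductivity_of_klRegime_of_klMechanismRelKL_of_ssbToTorusLRO`), and likewise the thin crux, the rate-keeping crux and
(+ (D_loc)) the typed `WcbcsBcsConstruction`.  CONSEQUENCE FOR THE PLAN (consumer side, numbers not adjectives): on the summit path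
through H3, crux K1 of `KLProgramme` is NOT load-bearing — it serves the LITERAL leaf (rung R2d's wording «for all `T ≥ W e^{-c/U²}`»)
and nothing downstream of it; the summit-critical content of the theorem half is K3.  The price is in the bridge: as hypotheses
(M_loc) ⇒ `hBrKL` ⇒ `hBr` (`klMechanismRelKL_of_klMechanism`, `klMechanismRel_of_klMechanismRelKL`), i.e. `hBrKL` is (weakly)
STRONGER than gen 0's `hBr` — it must produce the order floor from less normal-phase information (none at `β < e^{a/U}`); by the
honest reading of the door (gen 0 §3; audit `…KLBridgeAudit` §4: the antecedent is the existence SHADOW of stage 1 either way) this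
is no mathematical loss.

§1 `controlKL_at_mu_of_klRegime` / `controlKL_on_muWindow_of_klRegime` / `controlKL_on_levelWindow_of_klRegime` — the `δ → μ`
   transport of K3 (for each `a > 0`): KL-regime control at every `μ ∈ [-4,4]` with `13/20 ≤ n(μ) ≤ 9/10`, hence on the level window
   `[-21/50, -7/20]` (certified fillings `klwL_filling_ge`, `klwU_filling_le` of gen 0).
§2 `hBrKL` between (M_loc) and `hBr`; `shiftedWindowFloor_of_klRegime_of_klMechanismRelKL`; the four conclusions.
(The leaf trivially gives K3's body — the same `(U₀, c)` for every `a` — so the K3 door also runs from the leaf; gen 0's door covers that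
case with the weaker `hBr`, and no separate statement is recorded.)

Sorry-free, standard axioms, no definition; K3 / crux 2 / the typed crux BY NAME, (M_loc) / (D_loc) signatures byte-identical to the
registered stubs of stmt-2010, `hBr` byte-identical to gen 0's door.  Sources: T. Koma, H. Tasaki, J. Stat. Phys. 76 (1994) 745, §1;
G. Benfatto, A. Giuliani, V. Mastropietro, Ann. Henri Poincaré 7 (2006) 809, Thm 1.1 (the K1 regime); J. Feldman, J. Magnen,
V. Rivasseau, E. Trubowitz, Europhys. Lett. 24 (1993) 437 (stage 2); S. Raghu, S. A. Kivelson, D. J. Scalapino, Phys. Rev. B 81 (2010)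
224505, §II (4), §III Fig. 2.
-/

noncomputable section

-- the tree's namespace `Summit.<Summit>.<Problem>.Theorems` repeats the summit name by design (D-0017)
set_option linter.dupNamespace false

namespace Summit.HubbardSuperconductivity.HubbardSuperconductivity.Theorems.R2dH1

open Filter Set
open Literature.MathematicalPhysics.QuantumLattice Literature.Probability.LatticeModels
open Summit.HubbardSuperconductivity.HubbardSuperconductivity.Theses.WeakCouplingBCS
  (WcbcsSsbToTorusLRO WcbcsBcsConstruction)
open Summit.HubbardSuperconductivity.HubbardSuperconductivity.Theses.KLProgramme (KLRegimeTwoPointLimit)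
open scoped Topology

/-! ### §1 The `δ → μ` transport of crux K3 -/

/-- **K3 at a given chemical potential.** For every `a > 0` there are `U₀, c > 0` such that at every `μ ∈ [-4, 4]` with free
filling `13/20 ≤ n(μ) ≤ 9/10` (`δ := 1 - n(μ) ∈ [0.10, 0.35]`, `μ(δ) = μ`) the thermal two-point functions converge as `L → ∞` for all
`0 < U ≤ U₀`, `e^{a/U} ≤ β ≤ e^{c/U²}`. [cite: RaghuKivelsonScalapino2010, §II (4)] -/
theorem controlKL_at_mu_of_klRegime (h3 : KLRegimeTwoPointLimit) :
    ∀ a : ℝ, 0 < a → ∃ U₀ c : ℝ, 0 < U₀ ∧ 0 < c ∧ ∀ μ ∈ Set.Icc (-4 : ℝ) 4,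
      (13 : ℝ) / 20 ≤ KohnLuttinger.filling (squareDispersion 1 0) μ →
      KohnLuttinger.filling (squareDispersion 1 0) μ ≤ 9 / 10 →
      ∀ U β : ℝ, 0 < U → U ≤ U₀ → Real.exp (a / U) ≤ β → β ≤ Real.exp (c / U ^ 2) →
        ∀ (x y : Site 2) (σ σ' : Fin 2), ∃ S : ℂ,
          Tendsto (fun L : ℕ => hubbardThermalTwoPoint β U μ L x y σ σ') atTop (𝓝 S) := by
  intro a ha
  obtain ⟨U₀, c, hU₀, hc, H⟩ := h3 a ha
  refine ⟨U₀, c, hU₀, hc, fun μ hμ hn₁ hn₂ => ?_⟩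
  set n := KohnLuttinger.filling (squareDispersion 1 0) μ with hn
  have hδ : 1 - n ∈ Set.Icc (0.10 : ℝ) 0.35 := by
    constructor <;> norm_num <;> linarith
  have hμn : chemicalPotentialOfDensity (squareDispersion 1 0) (1 - (1 - n)) = μ := by
    rw [sub_sub_cancel]
    exact chemicalPotentialOfDensity_eq_of_filling_eq (by linarith) hμ rfl
  have key := H (1 - n) hδ
  rw [hμn] at key
  exact key

/-- **K3 on a `μ`-window with certified endpoint fillings** `13/20 ≤ n(μ₁)`, `n(μ₂) ≤ 9/10`, `[μ₁, μ₂] ⊆ [-4, 4]`. [folklore] -/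
theorem controlKL_on_muWindow_of_klRegime (h3 : KLRegimeTwoPointLimit) {μ₁ μ₂ : ℝ} (h4 : -4 ≤ μ₁) (h4' : μ₂ ≤ 4)
    (hn₁ : (13 : ℝ) / 20 ≤ KohnLuttinger.filling (squareDispersion 1 0) μ₁)
    (hn₂ : KohnLuttinger.filling (squareDispersion 1 0) μ₂ ≤ 9 / 10) :
    ∀ a : ℝ, 0 < a → ∃ U₀ c : ℝ, 0 < U₀ ∧ 0 < c ∧ ∀ μ ∈ Set.Icc μ₁ μ₂,
      ∀ U β : ℝ, 0 < U → U ≤ U₀ → Real.exp (a / U) ≤ β → β ≤ Real.exp (c / U ^ 2) →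
        ∀ (x y : Site 2) (σ σ' : Fin 2), ∃ S : ℂ,
          Tendsto (fun L : ℕ => hubbardThermalTwoPoint β U μ L x y σ σ') atTop (𝓝 S) := by
  intro a ha
  obtain ⟨U₀, c, hU₀, hc, H⟩ := controlKL_at_mu_of_klRegime h3 a ha
  refine ⟨U₀, c, hU₀, hc, fun μ hμ => H μ ⟨h4.trans hμ.1, hμ.2.trans h4'⟩ ?_ ?_⟩
  · exact hn₁.trans (monotone_filling hμ.1)
  · exact (monotone_filling hμ.2).trans hn₂

/-- **K3 on the level window `[-21/50, -7/20]`** (certified fillings `klwL_filling_ge : 13/20 ≤ n(-21/50)`,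
`klwU_filling_le : n(-7/20) ≤ 9/10`). [folklore] -/
theorem controlKL_on_levelWindow_of_klRegime (h3 : KLRegimeTwoPointLimit) :
    ∀ a : ℝ, 0 < a → ∃ U₀ c : ℝ, 0 < U₀ ∧ 0 < c ∧ ∀ μ ∈ Set.Icc (-(21:ℝ) / 50) (-(7:ℝ) / 20),
      ∀ U β : ℝ, 0 < U → U ≤ U₀ → Real.exp (a / U) ≤ β → β ≤ Real.exp (c / U ^ 2) →
        ∀ (x y : Site 2) (σ σ' : Fin 2), ∃ S : ℂ,
          Tendsto (fun L : ℕ => hubbardThermalTwoPoint β U μ L x y σ σ') atTop (𝓝 S) :=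
  controlKL_on_muWindow_of_klRegime h3 (by norm_num) (by norm_num) klwL_filling_ge klwU_filling_le

/-! ### §2 The bridge «(M_loc | KL-regime control)» and the door from K3 -/

/-- **(M_loc) implies its relativisation to KL-regime control** (`hBrKL` carries one more antecedent than crux 4's registered
research stub). [folklore] -/
theorem klMechanismRelKL_of_klMechanism
    (hM : ∀ μ₁ μ₂ γ U₁ : ℝ, -2 ≤ μ₁ → μ₁ < μ₂ → μ₂ ≤ -(3:ℝ) / 10 → 0 < γ → 0 < U₁ →
      (∀ U ∈ Set.Ioo (0:ℝ) U₁, ∀ μ ∈ Set.Icc μ₁ μ₂, ∀ χ : D4Irrep, χ ≠ D4Irrep.B1g →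
        channelInf (squareDispersion 1 0) μ U D4Irrep.B1g + γ * U ^ 2 ≤ channelInf (squareDispersion 1 0) μ U χ) →
      ∃ U₀ C : ℝ, 0 < U₀ ∧ 0 < C ∧ ∀ U ∈ Set.Ioo (0:ℝ) U₀, ∀ μ ∈ Set.Icc (μ₁ + U / 2) μ₂,
        Real.exp (-C / U ^ 2) ≤ dWaveOrderParameter U μ) :
    ∀ μ₁ μ₂ γ U₁ : ℝ, -2 ≤ μ₁ → μ₁ < μ₂ → μ₂ ≤ -(3:ℝ) / 10 → 0 < γ → 0 < U₁ →
      (∀ a : ℝ, 0 < a → ∃ U₀ c : ℝ, 0 < U₀ ∧ 0 < c ∧ ∀ μ ∈ Set.Icc μ₁ μ₂, ∀ U β : ℝ, 0 < U → U ≤ U₀ →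
        Real.exp (a / U) ≤ β → β ≤ Real.exp (c / U ^ 2) → ∀ (x y : Site 2) (σ σ' : Fin 2), ∃ S : ℂ,
          Tendsto (fun L : ℕ => hubbardThermalTwoPoint β U μ L x y σ σ') atTop (𝓝 S)) →
      (∀ U ∈ Set.Ioo (0:ℝ) U₁, ∀ μ ∈ Set.Icc μ₁ μ₂, ∀ χ : D4Irrep, χ ≠ D4Irrep.B1g →
        channelInf (squareDispersion 1 0) μ U D4Irrep.B1g + γ * U ^ 2 ≤ channelInf (squareDispersion 1 0) μ U χ) →
      ∃ U₀' C : ℝ, 0 < U₀' ∧ 0 < C ∧ ∀ U ∈ Set.Ioo (0:ℝ) U₀', ∀ μ ∈ Set.Icc (μ₁ + U / 2) μ₂,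
        Real.exp (-C / U ^ 2) ≤ dWaveOrderParameter U μ :=
  fun μ₁ μ₂ γ U₁ hμ₁ h12 hμ₂ hγ hU₁ _ hlead => hM μ₁ μ₂ γ U₁ hμ₁ h12 hμ₂ hγ hU₁ hlead

/-- **«(M_loc | KL-regime control)» implies gen 0's «(M_loc | normal-phase control)»**: full control (all `0 < β ≤ e^{c/U²}`, one
`(U₀, c)`) gives KL-regime control for every `a > 0` with the same constants, so `hBrKL` is the STRONGER hypothesis of the two.
[folklore] -/
theorem klMechanismRel_of_klMechanismRelKL
    (hBrKL : ∀ μ₁ μ₂ γ U₁ : ℝ, -2 ≤ μ₁ → μ₁ < μ₂ → μ₂ ≤ -(3:ℝ) / 10 → 0 < γ → 0 < U₁ →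
      (∀ a : ℝ, 0 < a → ∃ U₀ c : ℝ, 0 < U₀ ∧ 0 < c ∧ ∀ μ ∈ Set.Icc μ₁ μ₂, ∀ U β : ℝ, 0 < U → U ≤ U₀ →
        Real.exp (a / U) ≤ β → β ≤ Real.exp (c / U ^ 2) → ∀ (x y : Site 2) (σ σ' : Fin 2), ∃ S : ℂ,
          Tendsto (fun L : ℕ => hubbardThermalTwoPoint β U μ L x y σ σ') atTop (𝓝 S)) →
      (∀ U ∈ Set.Ioo (0:ℝ) U₁, ∀ μ ∈ Set.Icc μ₁ μ₂, ∀ χ : D4Irrep, χ ≠ D4Irrep.B1g →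
        channelInf (squareDispersion 1 0) μ U D4Irrep.B1g + γ * U ^ 2 ≤ channelInf (squareDispersion 1 0) μ U χ) →
      ∃ U₀' C : ℝ, 0 < U₀' ∧ 0 < C ∧ ∀ U ∈ Set.Ioo (0:ℝ) U₀', ∀ μ ∈ Set.Icc (μ₁ + U / 2) μ₂,
        Real.exp (-C / U ^ 2) ≤ dWaveOrderParameter U μ) :
    ∀ μ₁ μ₂ γ U₁ U₀ c : ℝ, -2 ≤ μ₁ → μ₁ < μ₂ → μ₂ ≤ -(3:ℝ) / 10 → 0 < γ → 0 < U₁ → 0 < U₀ → 0 < c →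
      (∀ μ ∈ Set.Icc μ₁ μ₂, ∀ U β : ℝ, 0 < U → U ≤ U₀ → 0 < β → β ≤ Real.exp (c / U ^ 2) →
        ∀ (x y : Site 2) (σ σ' : Fin 2), ∃ S : ℂ,
          Tendsto (fun L : ℕ => hubbardThermalTwoPoint β U μ L x y σ σ') atTop (𝓝 S)) →
      (∀ U ∈ Set.Ioo (0:ℝ) U₁, ∀ μ ∈ Set.Icc μ₁ μ₂, ∀ χ : D4Irrep, χ ≠ D4Irrep.B1g →
        channelInf (squareDispersion 1 0) μ U D4Irrep.B1g + γ * U ^ 2 ≤ channelInf (squareDispersion 1 0) μ U χ) →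
      ∃ U₀' C : ℝ, 0 < U₀' ∧ 0 < C ∧ ∀ U ∈ Set.Ioo (0:ℝ) U₀', ∀ μ ∈ Set.Icc (μ₁ + U / 2) μ₂,
        Real.exp (-C / U ^ 2) ≤ dWaveOrderParameter U μ := by
  intro μ₁ μ₂ γ U₁ U₀ c hμ₁ h12 hμ₂ hγ hU₁ hU₀ hc hctl hlead
  refine hBrKL μ₁ μ₂ γ U₁ hμ₁ h12 hμ₂ hγ hU₁ (fun a ha => ⟨U₀, c, hU₀, hc, ?_⟩) hlead
  intro μ hμ U β hU hUle haβ hβle x y σ σ'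
  exact hctl μ hμ U β hU hUle (lt_of_lt_of_le (Real.exp_pos _) haβ) hβle x y σ σ'

/-- **K3 + certificate + «(M_loc | KL-regime control)» ⇒ the order floor on the shifted windows `[-21/50 + U/2, -7/20]`.**
[cite: KomaTasaki1994, §1] -/
theorem shiftedWindowFloor_of_klRegime_of_klMechanismRelKL (h3 : KLRegimeTwoPointLimit)
    (hA : klCertB1gWinA.EnclosuresB1g) (hB : klCertB1gWinB.EnclosuresB1g) (hC : klCertB1gWinC.EnclosuresB1g)
    (hBrKL : ∀ μ₁ μ₂ γ U₁ : ℝ, -2 ≤ μ₁ → μ₁ < μ₂ → μ₂ ≤ -(3:ℝ) / 10 → 0 < γ → 0 < U₁ →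
      (∀ a : ℝ, 0 < a → ∃ U₀ c : ℝ, 0 < U₀ ∧ 0 < c ∧ ∀ μ ∈ Set.Icc μ₁ μ₂, ∀ U β : ℝ, 0 < U → U ≤ U₀ →
        Real.exp (a / U) ≤ β → β ≤ Real.exp (c / U ^ 2) → ∀ (x y : Site 2) (σ σ' : Fin 2), ∃ S : ℂ,
          Tendsto (fun L : ℕ => hubbardThermalTwoPoint β U μ L x y σ σ') atTop (𝓝 S)) →
      (∀ U ∈ Set.Ioo (0:ℝ) U₁, ∀ μ ∈ Set.Icc μ₁ μ₂, ∀ χ : D4Irrep, χ ≠ D4Irrep.B1g →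
        channelInf (squareDispersion 1 0) μ U D4Irrep.B1g + γ * U ^ 2 ≤ channelInf (squareDispersion 1 0) μ U χ) →
      ∃ U₀' C : ℝ, 0 < U₀' ∧ 0 < C ∧ ∀ U ∈ Set.Ioo (0:ℝ) U₀', ∀ μ ∈ Set.Icc (μ₁ + U / 2) μ₂,
        Real.exp (-C / U ^ 2) ≤ dWaveOrderParameter U μ) :
    ∃ U₀ C : ℝ, 0 < U₀ ∧ 0 < C ∧ ∀ U ∈ Set.Ioo (0:ℝ) U₀, ∀ μ ∈ Set.Icc (-(21:ℝ) / 50 + U / 2) (-(7:ℝ) / 20),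
      Real.exp (-C / U ^ 2) ≤ dWaveOrderParameter U μ := by
  obtain ⟨γ, hγ, hlead⟩ := r2dCert_leading_levelWindow hA hB hC
  have hlead' : ∀ U ∈ Set.Ioo (0:ℝ) 1, ∀ μ ∈ Set.Icc (-(21:ℝ) / 50) (-(7:ℝ) / 20), ∀ χ : D4Irrep,
      χ ≠ D4Irrep.B1g → channelInf (squareDispersion 1 0) μ U D4Irrep.B1g + γ * U ^ 2 ≤
        channelInf (squareDispersion 1 0) μ U χ :=
    fun U hU μ hμ χ hχ => hlead U hU μ ⟨le_trans (by norm_num) hμ.1, hμ.2⟩ χ hχ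
  exact hBrKL (-(21:ℝ) / 50) (-(7:ℝ) / 20) γ 1 (by norm_num) (by norm_num) (by norm_num) hγ one_pos
    (controlKL_on_levelWindow_of_klRegime h3) hlead'

/-- **THE K3 DOOR: crux K3 `KLRegimeTwoPointLimit` + certificate + «(M_loc | KL-regime control)» + crux 2 ⇒ the summit — no K1.**
Hypotheses: K3 BY NAME (route `KLProgramme`, stmt-HubbardSuperconductivity-19937, its five `…V7` children of record), the three window
enclosure records of R2d's certificate half (form (A)), the relativised research stub `hBrKL`, crux 2 `WcbcsSsbToTorusLRO` BY NAME.
Proof: §1 transport to `[-21/50, -7/20]`, the floor on `[-21/50 + U/2, -7/20]`, thin order (`thinOrder_of_shiftedWindowFloor`), thin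
sufficiency.  Every binder is load-bearing; `H10TwoPointLimit` (K1) does not occur. [cite: KomaTasaki1994, §1] -/
theorem hubbardSuperconductivity_of_klRegime_of_klMechanismRelKL_of_ssbToTorusLRO (h3 : KLRegimeTwoPointLimit)
    (hA : klCertB1gWinA.EnclosuresB1g) (hB : klCertB1gWinB.EnclosuresB1g) (hC : klCertB1gWinC.EnclosuresB1g)
    (hBrKL : ∀ μ₁ μ₂ γ U₁ : ℝ, -2 ≤ μ₁ → μ₁ < μ₂ → μ₂ ≤ -(3:ℝ) / 10 → 0 < γ → 0 < U₁ →
      (∀ a : ℝ, 0 < a → ∃ U₀ c : ℝ, 0 < U₀ ∧ 0 < c ∧ ∀ μ ∈ Set.Icc μ₁ μ₂, ∀ U β : ℝ, 0 < U → U ≤ U₀ →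
        Real.exp (a / U) ≤ β → β ≤ Real.exp (c / U ^ 2) → ∀ (x y : Site 2) (σ σ' : Fin 2), ∃ S : ℂ,
          Tendsto (fun L : ℕ => hubbardThermalTwoPoint β U μ L x y σ σ') atTop (𝓝 S)) →
      (∀ U ∈ Set.Ioo (0:ℝ) U₁, ∀ μ ∈ Set.Icc μ₁ μ₂, ∀ χ : D4Irrep, χ ≠ D4Irrep.B1g →
        channelInf (squareDispersion 1 0) μ U D4Irrep.B1g + γ * U ^ 2 ≤ channelInf (squareDispersion 1 0) μ U χ) →
      ∃ U₀' C : ℝ, 0 < U₀' ∧ 0 < C ∧ ∀ U ∈ Set.Ioo (0:ℝ) U₀', ∀ μ ∈ Set.Icc (μ₁ + U / 2) μ₂,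
        Real.exp (-C / U ^ 2) ≤ dWaveOrderParameter U μ)
    (h2 : WcbcsSsbToTorusLRO) : _root_.HubbardSuperconductivity :=
  hubbardSuperconductivity_of_wcbcsSsbToTorusLRO_of_thinOrder h2
    (thinOrder_of_shiftedWindowFloor (μ₁ := -(21:ℝ) / 50) (μ₂ := -(7:ℝ) / 20) (by norm_num) (by norm_num) le_rfl
      (shiftedWindowFloor_of_klRegime_of_klMechanismRelKL h3 hA hB hC hBrKL))

/-- **The thin crux from K3, the certificate and «(M_loc | KL-regime control)»** (no crux 2; `wcbcs_thinCrux_of_thinOrder`).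
[cite: KomaTasaki1994, §1] -/
theorem thinCrux_of_klRegime_of_klMechanismRelKL (h3 : KLRegimeTwoPointLimit)
    (hA : klCertB1gWinA.EnclosuresB1g) (hB : klCertB1gWinB.EnclosuresB1g) (hC : klCertB1gWinC.EnclosuresB1g)
    (hBrKL : ∀ μ₁ μ₂ γ U₁ : ℝ, -2 ≤ μ₁ → μ₁ < μ₂ → μ₂ ≤ -(3:ℝ) / 10 → 0 < γ → 0 < U₁ →
      (∀ a : ℝ, 0 < a → ∃ U₀ c : ℝ, 0 < U₀ ∧ 0 < c ∧ ∀ μ ∈ Set.Icc μ₁ μ₂, ∀ U β : ℝ, 0 < U → U ≤ U₀ →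
        Real.exp (a / U) ≤ β → β ≤ Real.exp (c / U ^ 2) → ∀ (x y : Site 2) (σ σ' : Fin 2), ∃ S : ℂ,
          Tendsto (fun L : ℕ => hubbardThermalTwoPoint β U μ L x y σ σ') atTop (𝓝 S)) →
      (∀ U ∈ Set.Ioo (0:ℝ) U₁, ∀ μ ∈ Set.Icc μ₁ μ₂, ∀ χ : D4Irrep, χ ≠ D4Irrep.B1g →
        channelInf (squareDispersion 1 0) μ U D4Irrep.B1g + γ * U ^ 2 ≤ channelInf (squareDispersion 1 0) μ U χ) →
      ∃ U₀' C : ℝ, 0 < U₀' ∧ 0 < C ∧ ∀ U ∈ Set.Ioo (0:ℝ) U₀', ∀ μ ∈ Set.Icc (μ₁ + U / 2) μ₂,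
        Real.exp (-C / U ^ 2) ≤ dWaveOrderParameter U μ) :
    ∀ U₁ : ℝ, 0 < U₁ → ∃ U ∈ Set.Ioo (0:ℝ) U₁, ∃ δ ∈ Set.Ioo (0:ℝ) (1 / 2), ∃ μ : ℝ,
      Tendsto (fun L : ℕ => ((hubbardTorusWith 2 (L + 1) 1 U μ).groundStateFunctional
        totalNumber).re / ((L + 1 : ℕ) : ℝ) ^ 2) atTop (𝓝 (1 - δ)) ∧ HasDWaveOrder U μ :=
  wcbcs_thinCrux_of_thinOrder
    (thinOrder_of_shiftedWindowFloor (μ₁ := -(21:ℝ) / 50) (μ₂ := -(7:ℝ) / 20) (by norm_num) (by norm_num) le_rfl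
      (shiftedWindowFloor_of_klRegime_of_klMechanismRelKL h3 hA hB hC hBrKL))

/-- **The rate-keeping crux (LINE-STATUS form (b)) from K3, the certificate and «(M_loc | KL-regime control)»** — no (D_loc), no K1.
[cite: KomaTasaki1994, §1] -/
theorem rateKeepingCrux_of_klRegime_of_klMechanismRelKL (h3 : KLRegimeTwoPointLimit)
    (hA : klCertB1gWinA.EnclosuresB1g) (hB : klCertB1gWinB.EnclosuresB1g) (hC : klCertB1gWinC.EnclosuresB1g)
    (hBrKL : ∀ μ₁ μ₂ γ U₁ : ℝ, -2 ≤ μ₁ → μ₁ < μ₂ → μ₂ ≤ -(3:ℝ) / 10 → 0 < γ → 0 < U₁ →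
      (∀ a : ℝ, 0 < a → ∃ U₀ c : ℝ, 0 < U₀ ∧ 0 < c ∧ ∀ μ ∈ Set.Icc μ₁ μ₂, ∀ U β : ℝ, 0 < U → U ≤ U₀ →
        Real.exp (a / U) ≤ β → β ≤ Real.exp (c / U ^ 2) → ∀ (x y : Site 2) (σ σ' : Fin 2), ∃ S : ℂ,
          Tendsto (fun L : ℕ => hubbardThermalTwoPoint β U μ L x y σ σ') atTop (𝓝 S)) →
      (∀ U ∈ Set.Ioo (0:ℝ) U₁, ∀ μ ∈ Set.Icc μ₁ μ₂, ∀ χ : D4Irrep, χ ≠ D4Irrep.B1g →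
        channelInf (squareDispersion 1 0) μ U D4Irrep.B1g + γ * U ^ 2 ≤ channelInf (squareDispersion 1 0) μ U χ) →
      ∃ U₀' C : ℝ, 0 < U₀' ∧ 0 < C ∧ ∀ U ∈ Set.Ioo (0:ℝ) U₀', ∀ μ ∈ Set.Icc (μ₁ + U / 2) μ₂,
        Real.exp (-C / U ^ 2) ≤ dWaveOrderParameter U μ) :
    ∃ U₀ : ℝ, 0 < U₀ ∧ ∃ C : ℝ, 0 < C ∧ ∀ U ∈ Set.Ioo (0:ℝ) U₀, ∃ δ ∈ Set.Ioo (0:ℝ) (1 / 2), ∃ μ : ℝ,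
      Tendsto (fun L : ℕ => ((hubbardTorusWith 2 (L + 1) 1 U μ).groundStateFunctional
        totalNumber).re / ((L + 1 : ℕ) : ℝ) ^ 2) atTop (𝓝 (1 - δ)) ∧
      Real.exp (-C / U ^ 2) ≤ dWaveOrderParameter U μ :=
  rateKeepingCrux_of_shiftedWindowFloor (μ₁ := -(21:ℝ) / 50) (μ₂ := -(7:ℝ) / 20) (by norm_num) (by norm_num) le_rfl
    (shiftedWindowFloor_of_klRegime_of_klMechanismRelKL h3 hA hB hC hBrKL)

/-- **The TYPED crux 4 `WcbcsBcsConstruction` BY NAME from K3, the certificate, «(M_loc | KL-regime control)» and (D_loc)**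
(`hD` VERBATIM; generic EOS composition of `…TypedCrux` on `[-21/50, -7/20]`, `n(-21/50) ≥ 13/20 > 1/2`) — no K1. [cite: KomaTasaki1994, §1] -/
theorem wcbcsBcsConstruction_of_klRegime_of_klMechanismRelKL_of_noDensityJump (h3 : KLRegimeTwoPointLimit)
    (hA : klCertB1gWinA.EnclosuresB1g) (hB : klCertB1gWinB.EnclosuresB1g) (hC : klCertB1gWinC.EnclosuresB1g)
    (hBrKL : ∀ μ₁ μ₂ γ U₁ : ℝ, -2 ≤ μ₁ → μ₁ < μ₂ → μ₂ ≤ -(3:ℝ) / 10 → 0 < γ → 0 < U₁ →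
      (∀ a : ℝ, 0 < a → ∃ U₀ c : ℝ, 0 < U₀ ∧ 0 < c ∧ ∀ μ ∈ Set.Icc μ₁ μ₂, ∀ U β : ℝ, 0 < U → U ≤ U₀ →
        Real.exp (a / U) ≤ β → β ≤ Real.exp (c / U ^ 2) → ∀ (x y : Site 2) (σ σ' : Fin 2), ∃ S : ℂ,
          Tendsto (fun L : ℕ => hubbardThermalTwoPoint β U μ L x y σ σ') atTop (𝓝 S)) →
      (∀ U ∈ Set.Ioo (0:ℝ) U₁, ∀ μ ∈ Set.Icc μ₁ μ₂, ∀ χ : D4Irrep, χ ≠ D4Irrep.B1g →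
        channelInf (squareDispersion 1 0) μ U D4Irrep.B1g + γ * U ^ 2 ≤ channelInf (squareDispersion 1 0) μ U χ) →
      ∃ U₀' C : ℝ, 0 < U₀' ∧ 0 < C ∧ ∀ U ∈ Set.Ioo (0:ℝ) U₀', ∀ μ ∈ Set.Icc (μ₁ + U / 2) μ₂,
        Real.exp (-C / U ^ 2) ≤ dWaveOrderParameter U μ)
    (hD : ∀ μ₁ μ₂ : ℝ, -2 ≤ μ₁ → μ₁ < μ₂ → μ₂ ≤ -(3:ℝ) / 10 → ∃ U_J : ℝ, 0 < U_J ∧ ∀ U ∈ Set.Ioo (0:ℝ) U_J,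
      ∀ ν ∈ Set.Icc μ₁ μ₂, ∀ ε > 0, ∃ h > 0, ∃ᶠ L : ℕ in atTop,
        ((hubbardTorusWith 2 (L + 1) 1 U (ν + h)).groundStateFunctional totalNumber).re / ((L + 1 : ℕ) : ℝ) ^ 2 -
          ((hubbardTorusWith 2 (L + 1) 1 U (ν - h)).groundStateFunctional totalNumber).re / ((L + 1 : ℕ) : ℝ) ^ 2 ≤ ε) :
    WcbcsBcsConstruction := by
  have hhalf : (1 : ℝ) / 2 < KohnLuttinger.filling (squareDispersion 1 0) (-(21:ℝ) / 50) :=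
    lt_of_lt_of_le (by norm_num) klwL_filling_ge
  exact wcbcsBcsConstruction_of_shiftedWindowFloor_of_noDensityJump (μ₁ := -(21:ℝ) / 50) (μ₂ := -(7:ℝ) / 20)
    (by norm_num) (by norm_num) (by norm_num) hhalf
    (shiftedWindowFloor_of_klRegime_of_klMechanismRelKL h3 hA hB hC hBrKL) hD

end Summit.HubbardSuperconductivity.HubbardSuperconductivity.Theorems.R2dH1

end
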